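import Summits.HodgeConjecture.CorCM.Census.CoinvariantFloor

/-!
# The half-parity law, I: half-block sets, the coboundary formula `∂ψ_A = χ_H ∪ 1_R`, and invariance on the coinvariant fibre

COR-CM (cell `pub-hodgecm2`), count-neutral kernel combinatorics by the binder seat b09 (gen 30; lane HALF-PARITY-LAW,
André-3's ask A6-R52), part I.  Two bookkeeping definitions (`hsum`, `sat`) + theorems; no `Prop`-valued definition, no
`decide` beyond `(1 : 𝔽₂) + 1 = 0`, no certificate, no named fact, no `sorry`; `Interfaces.lean` (C1), every E term, B01,
`Transposition/*` untouched.  HONEST FRAMING: `HC_CM` is NOT proved, here or anywhere in the tree; nothing here is a period.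

THE SETTING is the abstract currency of `Census/BlockParityLaw.lean` and `Census/CoinvariantFibre.lean`: `G` a finite group,
`c : G` an involution (central where stated), `CMF G c` the abstract CM types, `𝔽₂[types] = CMF G c →₀ 𝔽₂`, the base change
`rt c Q : Ψ ↦ Ψ·Q⁻¹` acting on `𝔽₂[types]` by `Finsupp.mapDomain`, the blocks `blk`, the block parities `par2`, and the mod-2
lattices `face2 ≤ hodge2 = face2 + pair2 ⊇ rad2 = pair2 + aug2`, whose quotient `hodge2 / rad2 ≅ (Λ ⊗ 𝔽₂)_G` is the
coinvariant fibre of dimension `φ₂(G, c) = fibreTwo`.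

WHY.  Gen 28 proved that base-change-invariant functionals of `𝔽₂[types]` cut out exactly `β − 1 − δ` conditions on the faces
(`Census/BlockParityExactRank`); gen 29 that every family of Hodge vectors generating the faces modulo pairs has `≥ φ₂` members
and `φ₂ ≥ β − 1 − δ` (`Census/CoinvariantFloor`), STRICTLY on `Q₈, Q₁₆, SD₁₆, M₁₆, ℤ/4×ℤ/2 (c ∈ 2G), Dic₆, ℤ/3×Q₈, …`.  André-3
(PORTFOLIO-lit-andre-3-g17 §0 (B), §3) found the mechanism of the excess: for an index-two subgroup `H ∋ c` and a parity
relation `R` whose blocks have their stabilisers inside `H`, every `R`-block splits into two `H`-halves, and the HALF-PARITY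
(sum of the coordinates over one half of each `R`-block) is `G`-invariant on the Hodge lattice although it is NOT the
restriction of an invariant functional of the ambient module — a transgression `χ_H ∪ 1_R`; on all 58 Galois CM types of
order `≤ 24` the parities and half-parities span ALL invariant functionals of `(Λ ⊗ 𝔽₂)_G` («`φ₂ = β − 1 − δ + t`»).  This file
proves the generic half of that law, for every `(G, c)`:

CONTENT.
* §1 **Half-sums** `hsum A : 𝔽₂[types] → 𝔽₂`, `x ↦ Σ_{Ψ ∈ A} x(Ψ)`; transport `hsum A (x·Q⁻¹) = hsum (A·Q) x` (`hsum_mapDomain_rt`).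
* §2 **Stable sets and saturation**: a `K`-stable `A` (`A·Q⁻¹ = A`, `Q ∈ K`) has `K`-invariant `hsum A` on ALL of `𝔽₂[types]`;
  the saturation `sat A = G·A` is a union of blocks and `hsum (sat A) = Σ_{b ∈ blk(sat A)} par2_b` is a block-parity
  combination (`hsum_sat_eq_sum_par2`).
* §3 **Half-block sets** (`H`-stable `A` disjoint from `A·Q⁻¹` for `Q ∉ H`).  For `H` of index two the dichotomy
  `A·Q⁻¹ = A` (`Q ∈ H`) / `A·Q⁻¹ = sat A ∖ A` (`Q ∉ H`, `image_rt_eq_sdiff`) gives THE COBOUNDARY FORMULA on ALL of `𝔽₂[types]`: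
  **`hsum A (x·Q⁻¹) = hsum A x + hsum (sat A) x` for `Q ∉ H`** (`hsum_mapDomain_rt_of_notMem`) — `∂ψ_A = χ_H ∪ 1_R`, `χ_H` the
  character of `G/H`, `1_R = hsum (sat A)` the indicator relation of the blocks `R` of `A`.
* §4 **Pairs**: `c ∈ K`, `A` `K`-stable ⇒ `hsum A` kills `pair2` (`pair2_le_ker_hsum`).
* §5 **MAIN** (`rad2_le_ker_hsum`, `hsum_mapDomain_rt_of_mem_hodge2`): if moreover `R` is a PARITY RELATION on the faces
  (`face2 ≤ ker hsum (sat A)`; by gen 28 `annihilator_cases`: `R` = all blocks, or a weight-parity class when `δ = 1`), then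
  `hsum A` kills `rad2 = pairs + coboundaries` and is `G`-invariant on `hodge2`: **a `G`-invariant functional on the coinvariant
  fibre `(Λ ⊗ 𝔽₂)_G`** (`hsumQ`), for every `(G, c)`, no census; integral form of the relation hypothesis
  (`face2_le_ker_hsum_of_sum_par_eq_zero`), and the saturated case `sat A` = all types (`rad2_le_ker_hsum_of_forall_mem_sat`).
* §6 **Transgression**: the base-change-invariant functionals of the AMBIENT `𝔽₂[types]` are exactly the block-parity
  combinations (`exists_eq_sum_par2_of_invariant`, Frobenius reciprocity); so a half-parity that is not a parity combination on
  the faces is the restriction of NO invariant ambient functional (`not_exists_invariant_extension`) — the excess over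
  `β − 1 − δ` is invisible to the invariant theory of the permutation module.
Parts II–IV: admissibility `⟺ Stab ≤ H` and the relations (`Census/HalfParityBlocks`), the floor `β − 1 − δ + t ≤ φ₂ ≤ |S|`
(`Census/HalfParityFloor`), `F`-forms (`CorCM/FaceHalfParityFloor`).

## References
* [Pohlmann1968] H. Pohlmann, Algebraic cycles on abelian varieties of complex multiplication type, Ann. of Math. 88 (1968), Thm 1.
* [Milne1999] J. S. Milne, Lefschetz motives and the Tate conjecture, Compositio Math. 117 (1999), Prop. 2.1, p. 54.
-/

namespace Summit.HodgeConjecture.CorCM.Census.HalfParity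

open Finset
open Summit.HodgeConjecture.CorCM.Prior.AllgGroup.RfwfAllgGroup
open Summit.HodgeConjecture.CorCM.Census.BlockParity
open Summit.HodgeConjecture.CorCM.Census.Coinvariant

noncomputable section

variable {G : Type*} [Group G] [Fintype G] [DecidableEq G] (c : G)

/-! ## §1 Half-sums and their transport -/

/-- **The sum functional** of a finite set `A` of types: `hsum A x = Σ_{Ψ ∈ A} x(Ψ) ∈ 𝔽₂`. [folklore] -/
def hsum (A : Finset (CMF G c)) : (CMF G c →₀ ZMod 2) →ₗ[ZMod 2] ZMod 2 := ∑ Ψ ∈ A, Finsupp.lapply Ψ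

/-- `hsum A x = Σ_{Ψ ∈ A} x(Ψ)`. [folklore] -/
@[simp] theorem hsum_apply (A : Finset (CMF G c)) (x : CMF G c →₀ ZMod 2) : hsum c A x = ∑ Ψ ∈ A, x Ψ := by
  rw [hsum, LinearMap.sum_apply]
  rfl

/-- `hsum A [Ψ]·a = [Ψ ∈ A]·a`. [folklore] -/
theorem hsum_single (A : Finset (CMF G c)) (Ψ : CMF G c) (a : ZMod 2) :
    hsum c A (Finsupp.single Ψ a) = if Ψ ∈ A then a else 0 := by
  rw [hsum_apply]
  simp_rw [Finsupp.single_apply]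
  exact Finset.sum_ite_eq A Ψ fun _ => a

/-- `hsum (B ∖ A) = hsum B + hsum A` for `A ⊆ B` (characteristic `2`). [folklore] -/
theorem hsum_sdiff_apply {A B : Finset (CMF G c)} (h : A ⊆ B) (x : CMF G c →₀ ZMod 2) :
    hsum c (B \ A) x = hsum c B x + hsum c A x := by
  rw [hsum_apply, hsum_apply, hsum_apply, Finset.sum_sdiff_eq_sub h, sub_eq_add_neg, ZMod.neg_eq_self_mod_two]

/-- **Coordinates after base change**: `(x·Q⁻¹)(Ψ) = x(Ψ·Q)`, i.e. `(mapDomain (rt Q) x) Ψ = x (rt Q⁻¹ Ψ)`. [folklore] -/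
theorem mapDomain_rt_apply {M : Type*} [AddCommMonoid M] (Q : G) (x : CMF G c →₀ M) (Ψ : CMF G c) :
    Finsupp.mapDomain (rt c Q) x Ψ = x (rt c Q⁻¹ Ψ) := by
  conv_lhs => rw [← rt_rt_inv c Q Ψ]
  exact Finsupp.mapDomain_apply (rt_bijective c Q).injective x (rt c Q⁻¹ Ψ)

/-- **Transport of half-sums**: `hsum A (x·Q⁻¹) = hsum (A·Q) x`, where `A·Q = rt Q⁻¹ '' A`. [folklore] -/
theorem hsum_mapDomain_rt (A : Finset (CMF G c)) (Q : G) (x : CMF G c →₀ ZMod 2) :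
    hsum c A (Finsupp.mapDomain (rt c Q) x) = hsum c (A.image (rt c Q⁻¹)) x := by
  rw [hsum_apply, hsum_apply, Finset.sum_image fun Ψ _ Ψ' _ h => (rt_bijective c Q⁻¹).injective h]
  exact Finset.sum_congr rfl fun Ψ _ => mapDomain_rt_apply c Q x Ψ

/-! ## §2 Stable sets and the saturation `G·A` -/

/-- A `K`-stable set (`A·Q⁻¹ ⊆ A` for `Q ∈ K`) is permuted by every `Q ∈ K`: `A·Q⁻¹ = A`. [folklore] -/
theorem image_rt_eq_of_stable {K : Subgroup G} {A : Finset (CMF G c)} (hA : ∀ Q ∈ K, ∀ Ψ ∈ A, rt c Q Ψ ∈ A) {Q : G}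
    (hQ : Q ∈ K) : A.image (rt c Q) = A := by
  apply Finset.Subset.antisymm
  · intro Ψ' h
    obtain ⟨Ψ, hΨ, rfl⟩ := mem_image.mp h
    exact hA Q hQ Ψ hΨ
  · intro Ψ hΨ
    exact mem_image.mpr ⟨rt c Q⁻¹ Ψ, hA Q⁻¹ (K.inv_mem hQ) Ψ hΨ, rt_rt_inv c Q Ψ⟩

/-- **`K`-invariance of `hsum A`** for `K`-stable `A`: `hsum A (x·Q⁻¹) = hsum A x`, `Q ∈ K`, on ALL of `𝔽₂[types]`. [folklore] -/
theorem hsum_mapDomain_rt_of_stable {K : Subgroup G} {A : Finset (CMF G c)} (hA : ∀ Q ∈ K, ∀ Ψ ∈ A, rt c Q Ψ ∈ A) {Q : G}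
    (hQ : Q ∈ K) (x : CMF G c →₀ ZMod 2) : hsum c A (Finsupp.mapDomain (rt c Q) x) = hsum c A x := by
  rw [hsum_mapDomain_rt, image_rt_eq_of_stable c hA (K.inv_mem hQ)]

/-- **The saturation** `sat A = G·A`: all base changes of members of `A` (a union of blocks). [folklore] -/
def sat (A : Finset (CMF G c)) : Finset (CMF G c) := A.biUnion fun Ψ => univ.image fun Q : G => rt c Q Ψ

/-- `Ψ ∈ sat A ↔` some base change of `Ψ` lies in `A`. [folklore] -/
theorem mem_sat (A : Finset (CMF G c)) (Ψ : CMF G c) : Ψ ∈ sat c A ↔ ∃ Q : G, rt c Q Ψ ∈ A := by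
  simp only [sat, mem_biUnion, mem_image, mem_univ, true_and]
  constructor
  · rintro ⟨Ψ', hΨ', Q, rfl⟩
    exact ⟨Q⁻¹, by rwa [rt_inv_rt]⟩
  · rintro ⟨Q, hQ⟩
    exact ⟨rt c Q Ψ, hQ, Q⁻¹, rt_inv_rt c Q Ψ⟩

/-- `A ⊆ sat A`. [folklore] -/
theorem subset_sat (A : Finset (CMF G c)) : A ⊆ sat c A := fun Ψ hΨ => (mem_sat c A Ψ).mpr ⟨1, by rwa [rt_one]⟩

/-- The saturation is stable under every base change. [folklore] -/
theorem rt_mem_sat {A : Finset (CMF G c)} (Q : G) {Ψ : CMF G c} (hΨ : Ψ ∈ sat c A) : rt c Q Ψ ∈ sat c A := by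
  obtain ⟨Q', hQ'⟩ := (mem_sat c A Ψ).mp hΨ
  exact (mem_sat c A _).mpr ⟨Q' * Q⁻¹, by rwa [rt_mul, rt_inv_rt]⟩

/-- The saturation is `G`-stable (`K = ⊤`). [folklore] -/
theorem sat_stable (A : Finset (CMF G c)) : ∀ Q ∈ (⊤ : Subgroup G), ∀ Ψ ∈ sat c A, rt c Q Ψ ∈ sat c A :=
  fun Q _ _ hΨ => rt_mem_sat c Q hΨ

/-- **`hsum (sat A)` is base-change invariant on all of `𝔽₂[types]`.** [folklore] -/
theorem hsum_sat_mapDomain_rt (A : Finset (CMF G c)) (Q : G) (x : CMF G c →₀ ZMod 2) :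
    hsum c (sat c A) (Finsupp.mapDomain (rt c Q) x) = hsum c (sat c A) x :=
  hsum_mapDomain_rt_of_stable c (sat_stable c A) (Subgroup.mem_top Q) x

/-- Membership in a `G`-stable set depends only on the block. [folklore] -/
theorem mem_iff_blk_mem_image {B : Finset (CMF G c)} (hB : ∀ Q ∈ (⊤ : Subgroup G), ∀ Ψ ∈ B, rt c Q Ψ ∈ B) (Ψ : CMF G c) :
    Ψ ∈ B ↔ blk c Ψ ∈ B.image (blk c) := by
  refine ⟨fun h => mem_image_of_mem _ h, fun h => ?_⟩
  obtain ⟨Ψ', hΨ', he⟩ := mem_image.mp h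
  obtain ⟨Q, rfl⟩ := exists_rt_eq_of_blk_eq c he
  exact hB Q (Subgroup.mem_top Q) Ψ' hΨ'

/-- `Σ_b a_b · par2([Ψ]·r)_b = r · a(blk Ψ)`. [folklore] -/
theorem sum_mul_par2_single (a : Block c → ZMod 2) (Ψ : CMF G c) (r : ZMod 2) :
    ∑ b, a b * par2 c (Finsupp.single Ψ r) b = r * a (blk c Ψ) := by
  simp_rw [par2_single, Pi.smul_apply, Pi.single_apply, smul_eq_mul, mul_ite, mul_one, mul_zero]
  rw [Finset.sum_ite_eq' univ (blk c Ψ), if_pos (Finset.mem_univ _), mul_comm]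

/-- `Σ_{b ∈ R} par2([Ψ]·r)_b = [blk Ψ ∈ R]·r`. [folklore] -/
theorem sum_par2_single (R : Finset (Block c)) (Ψ : CMF G c) (r : ZMod 2) :
    ∑ b ∈ R, par2 c (Finsupp.single Ψ r) b = if blk c Ψ ∈ R then r else 0 := by
  simp_rw [par2_single, Pi.smul_apply, Pi.single_apply, smul_eq_mul, mul_ite, mul_one, mul_zero]
  exact Finset.sum_ite_eq' R (blk c Ψ) fun _ => r

/-- **A `G`-stable half-sum is a block-parity combination**: `hsum B = Σ_{b ∈ blk(B)} par2_b`. [folklore] -/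
theorem hsum_eq_sum_par2_of_stable {B : Finset (CMF G c)} (hB : ∀ Q ∈ (⊤ : Subgroup G), ∀ Ψ ∈ B, rt c Q Ψ ∈ B)
    (x : CMF G c →₀ ZMod 2) : hsum c B x = ∑ b ∈ B.image (blk c), par2 c x b := by
  induction x using Finsupp.induction_linear with
  | zero => simp
  | add f g hf hg => rw [map_add, hf, hg, ← Finset.sum_add_distrib]; simp only [map_add, Pi.add_apply]
  | single Ψ r =>
    rw [hsum_single, sum_par2_single]
    by_cases h : Ψ ∈ B
    · rw [if_pos h, if_pos ((mem_iff_blk_mem_image c hB Ψ).mp h)]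
    · rw [if_neg h, if_neg (fun h' => h ((mem_iff_blk_mem_image c hB Ψ).mpr h'))]

/-- In particular **`hsum (sat A) = Σ_{b ∈ R} par2_b`** with `R = blk(sat A)`, the blocks met by `A`. [folklore] -/
theorem hsum_sat_eq_sum_par2 (A : Finset (CMF G c)) (x : CMF G c →₀ ZMod 2) :
    hsum c (sat c A) x = ∑ b ∈ (sat c A).image (blk c), par2 c x b :=
  hsum_eq_sum_par2_of_stable c (sat_stable c A) x

/-! ## §3 Half-block sets of an index-two subgroup and the coboundary formula -/

/-- For an `H`-stable `A`: a type outside `A` is moved into `A` only by elements OUTSIDE `H`. [folklore] -/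
theorem notMem_of_rt_mem {H : Subgroup G} {A : Finset (CMF G c)} (hst : ∀ Q ∈ H, ∀ Ψ ∈ A, rt c Q Ψ ∈ A) {Ψ : CMF G c}
    (hΨ : Ψ ∉ A) {Q : G} (hQ : rt c Q Ψ ∈ A) : Q ∉ H := fun hQH =>
  hΨ (by simpa [rt_inv_rt] using hst Q⁻¹ (H.inv_mem hQH) _ hQ)

/-- **The index-two dichotomy, outside `H`.**  For a HALF-BLOCK SET `A` of `H` (`H`-stable, disjoint from `A·Q⁻¹` for
`Q ∉ H`) and `H` of index two: `A·Q⁻¹ = sat A ∖ A` for every `Q ∉ H`. [folklore] -/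
theorem image_rt_eq_sdiff {H : Subgroup G} (hH : H.index = 2) {A : Finset (CMF G c)}
    (hst : ∀ Q ∈ H, ∀ Ψ ∈ A, rt c Q Ψ ∈ A) (hdj : ∀ Q ∉ H, ∀ Ψ ∈ A, rt c Q Ψ ∉ A) {Q : G} (hQ : Q ∉ H) :
    A.image (rt c Q) = sat c A \ A := by
  apply Finset.Subset.antisymm
  · intro Ψ' h
    obtain ⟨Ψ, hΨ, rfl⟩ := mem_image.mp h
    exact mem_sdiff.mpr ⟨(mem_sat c A _).mpr ⟨Q⁻¹, by rwa [rt_inv_rt]⟩, hdj Q hQ Ψ hΨ⟩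
  · intro Ψ' h
    obtain ⟨hsat, hΨ'⟩ := mem_sdiff.mp h
    obtain ⟨Q', hQ'⟩ := (mem_sat c A Ψ').mp hsat
    have hQ'H : Q' ∉ H := notMem_of_rt_mem c hst hΨ' hQ'
    have hprod : Q⁻¹ * Q'⁻¹ ∈ H := by
      rw [Subgroup.mul_mem_iff_of_index_two hH, H.inv_mem_iff, H.inv_mem_iff]
      exact ⟨fun h => absurd h hQ, fun h => absurd h hQ'H⟩
    refine mem_image.mpr ⟨rt c Q⁻¹ Ψ', ?_, rt_rt_inv c Q Ψ'⟩
    have e : rt c Q⁻¹ Ψ' = rt c (Q⁻¹ * Q'⁻¹) (rt c Q' Ψ') := by rw [← rt_mul, inv_mul_cancel_right]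
    rw [e]
    exact hst _ hprod _ hQ'

/-- **THE COBOUNDARY FORMULA, outside `H`**: `hsum A (x·Q⁻¹) = hsum A x + hsum (sat A) x` for `Q ∉ H`, on ALL of
`𝔽₂[types]` (`∂ψ_A = χ_H ∪ 1_R`). [folklore] -/
theorem hsum_mapDomain_rt_of_notMem {H : Subgroup G} (hH : H.index = 2) {A : Finset (CMF G c)}
    (hst : ∀ Q ∈ H, ∀ Ψ ∈ A, rt c Q Ψ ∈ A) (hdj : ∀ Q ∉ H, ∀ Ψ ∈ A, rt c Q Ψ ∉ A) {Q : G} (hQ : Q ∉ H)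
    (x : CMF G c →₀ ZMod 2) : hsum c A (Finsupp.mapDomain (rt c Q) x) = hsum c A x + hsum c (sat c A) x := by
  have hQ' : Q⁻¹ ∉ H := fun h => hQ (by simpa using H.inv_mem h)
  rw [hsum_mapDomain_rt, image_rt_eq_sdiff c hH hst hdj hQ', hsum_sdiff_apply c (subset_sat c A), add_comm]

/-- **The coboundary formula, inside `H`**: `hsum A (x·Q⁻¹) = hsum A x` for `Q ∈ H` (only `H`-stability is used). [folklore] -/
theorem hsum_mapDomain_rt_of_mem {H : Subgroup G} {A : Finset (CMF G c)} (hst : ∀ Q ∈ H, ∀ Ψ ∈ A, rt c Q Ψ ∈ A) {Q : G}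
    (hQ : Q ∈ H) (x : CMF G c →₀ ZMod 2) : hsum c A (Finsupp.mapDomain (rt c Q) x) = hsum c A x :=
  hsum_mapDomain_rt_of_stable c hst hQ x

/-- In block language: **`hsum A (x·Q⁻¹) = hsum A x + Σ_{b ∈ R} par2(x)_b`** for `Q ∉ H`, `R = blk(sat A)`. [folklore] -/
theorem hsum_mapDomain_rt_eq_add_sum_par2 {H : Subgroup G} (hH : H.index = 2) {A : Finset (CMF G c)}
    (hst : ∀ Q ∈ H, ∀ Ψ ∈ A, rt c Q Ψ ∈ A) (hdj : ∀ Q ∉ H, ∀ Ψ ∈ A, rt c Q Ψ ∉ A) {Q : G} (hQ : Q ∉ H)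
    (x : CMF G c →₀ ZMod 2) :
    hsum c A (Finsupp.mapDomain (rt c Q) x) = hsum c A x + ∑ b ∈ (sat c A).image (blk c), par2 c x b := by
  rw [hsum_mapDomain_rt_of_notMem c hH hst hdj hQ, hsum_sat_eq_sum_par2]

/-! ## §4 Pairs -/

/-- For `K`-stable `A` with `c ∈ K`: `Ψ·c ∈ A ↔ Ψ ∈ A`. [folklore] -/
theorem rt_self_mem_iff {K : Subgroup G} {A : Finset (CMF G c)} (hA : ∀ Q ∈ K, ∀ Ψ ∈ A, rt c Q Ψ ∈ A) (hcK : c ∈ K)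
    (Ψ : CMF G c) : rt c c Ψ ∈ A ↔ Ψ ∈ A :=
  ⟨fun h => by simpa [rt_inv_rt] using hA c⁻¹ (K.inv_mem hcK) _ h, fun h => hA c hcK Ψ h⟩

/-- **`hsum A` kills the pairs** `[Ψ] + [Ψ·c]` when `A` is `K`-stable and `c ∈ K`. [folklore] -/
theorem hsum_red_pair {K : Subgroup G} {A : Finset (CMF G c)} (hA : ∀ Q ∈ K, ∀ Ψ ∈ A, rt c Q Ψ ∈ A) (hcK : c ∈ K)
    (Ψ : CMF G c) : hsum c A (red c (pair c Ψ)) = 0 := by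
  rw [red_pair, map_add, hsum_single, hsum_single]
  by_cases h : Ψ ∈ A
  · rw [if_pos h, if_pos ((rt_self_mem_iff c hA hcK Ψ).mpr h)]; decide
  · rw [if_neg h, if_neg (fun h' => h ((rt_self_mem_iff c hA hcK Ψ).mp h')), add_zero]

/-- `pair2 ≤ ker (hsum A)` for `K`-stable `A`, `c ∈ K`. [folklore] -/
theorem pair2_le_ker_hsum {K : Subgroup G} {A : Finset (CMF G c)} (hA : ∀ Q ∈ K, ∀ Ψ ∈ A, rt c Q Ψ ∈ A) (hcK : c ∈ K) :
    pair2 c ≤ LinearMap.ker (hsum c A) := by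
  rw [pair2, Submodule.span_le]
  rintro _ ⟨_, ⟨Ψ, rfl⟩, rfl⟩
  rw [SetLike.mem_coe, LinearMap.mem_ker]
  exact hsum_red_pair c hA hcK Ψ

/-- The saturation kills the pairs (it is `G`-stable). [folklore] -/
theorem pair2_le_ker_hsum_sat (A : Finset (CMF G c)) : pair2 c ≤ LinearMap.ker (hsum c (sat c A)) :=
  pair2_le_ker_hsum c (sat_stable c A) (Subgroup.mem_top c)

/-! ## §5 MAIN: a relation on the faces makes the half-parity a functional on the coinvariant fibre -/

/-- If `hsum (sat A)` vanishes on the faces mod `2`, it vanishes on the whole Hodge lattice mod `2`. [folklore] -/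
theorem hodge2_le_ker_hsum_sat {hc2 : c * c = 1} {A : Finset (CMF G c)}
    (hrel : face2 c hc2 ≤ LinearMap.ker (hsum c (sat c A))) : hodge2 c hc2 ≤ LinearMap.ker (hsum c (sat c A)) :=
  sup_le hrel (pair2_le_ker_hsum_sat c A)

/-- **Coboundaries of faces die**: `aug2 ≤ ker (hsum A)` when `A` is a half-block set of an index-two `H` and `hsum (sat A)`
is a relation on the faces. [folklore] -/
theorem aug2_le_ker_hsum {hc2 : c * c = 1} {H : Subgroup G} (hH : H.index = 2) {A : Finset (CMF G c)}
    (hst : ∀ Q ∈ H, ∀ Ψ ∈ A, rt c Q Ψ ∈ A) (hdj : ∀ Q ∉ H, ∀ Ψ ∈ A, rt c Q Ψ ∉ A)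
    (hrel : face2 c hc2 ≤ LinearMap.ker (hsum c (sat c A))) : aug2 c hc2 ≤ LinearMap.ker (hsum c A) := by
  rw [aug2, Submodule.span_le]
  rintro _ ⟨Q, x, hx, rfl⟩
  rw [SetLike.mem_coe, LinearMap.mem_ker, map_sub]
  by_cases hQ : Q ∈ H
  · rw [hsum_mapDomain_rt_of_mem c hst hQ, sub_self]
  · rw [hsum_mapDomain_rt_of_notMem c hH hst hdj hQ, add_sub_cancel_left]
    exact LinearMap.mem_ker.mp (hrel (Submodule.subset_span hx))

/-- **MAIN.  The half-parity kills the radical**: `rad2 = pairs + coboundaries ≤ ker (hsum A)` for a half-block set `A` of an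
index-two subgroup `H ∋ c` whose saturation carries a parity relation on the faces — `hsum A` IS a functional on the
coinvariant fibre `hodge2 / rad2 ≅ (Λ ⊗ 𝔽₂)_G`, for every `(G, c)`, no census. [folklore] -/
theorem rad2_le_ker_hsum {hc2 : c * c = 1} {H : Subgroup G} (hH : H.index = 2) (hcH : c ∈ H) {A : Finset (CMF G c)}
    (hst : ∀ Q ∈ H, ∀ Ψ ∈ A, rt c Q Ψ ∈ A) (hdj : ∀ Q ∉ H, ∀ Ψ ∈ A, rt c Q Ψ ∉ A)
    (hrel : face2 c hc2 ≤ LinearMap.ker (hsum c (sat c A))) : rad2 c hc2 ≤ LinearMap.ker (hsum c A) :=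
  sup_le (pair2_le_ker_hsum c hst hcH) (aug2_le_ker_hsum c hH hst hdj hrel)

/-- **`G`-invariance on the Hodge lattice**: `hsum A (x·Q⁻¹) = hsum A x` for EVERY `Q ∈ G` and every `x ∈ hodge2`. [folklore] -/
theorem hsum_mapDomain_rt_of_mem_hodge2 {hc2 : c * c = 1} {H : Subgroup G} (hH : H.index = 2) {A : Finset (CMF G c)}
    (hst : ∀ Q ∈ H, ∀ Ψ ∈ A, rt c Q Ψ ∈ A) (hdj : ∀ Q ∉ H, ∀ Ψ ∈ A, rt c Q Ψ ∉ A)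
    (hrel : face2 c hc2 ≤ LinearMap.ker (hsum c (sat c A))) (Q : G) {x : CMF G c →₀ ZMod 2} (hx : x ∈ hodge2 c hc2) :
    hsum c A (Finsupp.mapDomain (rt c Q) x) = hsum c A x := by
  by_cases hQ : Q ∈ H
  · exact hsum_mapDomain_rt_of_mem c hst hQ x
  · rw [hsum_mapDomain_rt_of_notMem c hH hst hdj hQ, LinearMap.mem_ker.mp (hodge2_le_ker_hsum_sat c hrel hx), add_zero]

/-- **The half-parity on the coinvariant quotient** `𝔽₂[types] / rad2` (its restriction to `fibre` is the functional on
`(Λ ⊗ 𝔽₂)_G`). [folklore] -/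
def hsumQ (hc2 : c * c = 1) {A : Finset (CMF G c)} (h : rad2 c hc2 ≤ LinearMap.ker (hsum c A)) :
    ((CMF G c →₀ ZMod 2) ⧸ rad2 c hc2) →ₗ[ZMod 2] ZMod 2 :=
  (rad2 c hc2).liftQ (hsum c A) h

/-- `hsumQ [x] = hsum A x`. [folklore] -/
@[simp] theorem hsumQ_mkQ (hc2 : c * c = 1) {A : Finset (CMF G c)} (h : rad2 c hc2 ≤ LinearMap.ker (hsum c A))
    (x : CMF G c →₀ ZMod 2) : hsumQ c hc2 h ((rad2 c hc2).mkQ x) = hsum c A x :=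
  rfl

/-- **Relation hypothesis, integral form**: if `Σ_{b ∈ R} par(face)_b = 0` for every face, `R = blk(B)` for a `G`-stable `B`,
then `face2 ≤ ker (hsum B)`. [folklore] -/
theorem face2_le_ker_hsum_of_sum_par_eq_zero {hc2 : c * c = 1} {B : Finset (CMF G c)}
    (hB : ∀ Q ∈ (⊤ : Subgroup G), ∀ Ψ ∈ B, rt c Q Ψ ∈ B)
    (hR : ∀ (Φ : CMF G c) (t t' : G), t' ∉ orb c t → ∑ b ∈ B.image (blk c), par c (gface c hc2 Φ t t') b = 0) :
    face2 c hc2 ≤ LinearMap.ker (hsum c B) := by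
  rw [face2, Submodule.span_le]
  rintro _ ⟨_, ⟨Φ, t, t', ht', rfl⟩, rfl⟩
  rw [SetLike.mem_coe, LinearMap.mem_ker, hsum_eq_sum_par2_of_stable c hB]
  simp_rw [par2_red]
  exact hR Φ t t' ht'

/-- Conversely, if `hsum B` (`B` `G`-stable) kills `face2`, then `Σ_{b ∈ blk(B)} par(face)_b = 0` for every face. [folklore] -/
theorem sum_par_eq_zero_of_face2_le_ker_hsum {hc2 : c * c = 1} {B : Finset (CMF G c)}
    (hB : ∀ Q ∈ (⊤ : Subgroup G), ∀ Ψ ∈ B, rt c Q Ψ ∈ B) (h : face2 c hc2 ≤ LinearMap.ker (hsum c B))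
    (Φ : CMF G c) {t t' : G} (ht' : t' ∉ orb c t) : ∑ b ∈ B.image (blk c), par c (gface c hc2 Φ t t') b = 0 := by
  have hf : red c (gface c hc2 Φ t t') ∈ face2 c hc2 := Submodule.subset_span (red_mem_faces2 c hc2 ⟨Φ, t, t', ht', rfl⟩)
  have h0 := LinearMap.mem_ker.mp (h hf)
  rw [hsum_eq_sum_par2_of_stable c hB] at h0
  simp_rw [par2_red] at h0
  exact h0

/-- **The total parity relation**: if `sat A` is ALL types, `hsum (sat A)` kills the faces (part I `sum_par_gface`). [folklore] -/
theorem face2_le_ker_hsum_sat_of_forall_mem {hc2 : c * c = 1} {A : Finset (CMF G c)} (hsat : ∀ Ψ, Ψ ∈ sat c A) :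
    face2 c hc2 ≤ LinearMap.ker (hsum c (sat c A)) := by
  refine face2_le_ker_hsum_of_sum_par_eq_zero c (sat_stable c A) fun Φ t t' _ => ?_
  have huniv : (sat c A).image (blk c) = univ :=
    eq_univ_of_forall fun b => by obtain ⟨Ψ, rfl⟩ := blk_surjective c b; exact mem_image_of_mem _ (hsat Ψ)
  rw [huniv]
  exact sum_par_gface c hc2 Φ t t'

/-- **MAIN, saturated form**: a half-block set of `H ∋ c` meeting EVERY block (every stabiliser inside `H`; total-parity
relation) gives a functional on the coinvariant fibre, for every `(G, c)`. [folklore] -/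
theorem rad2_le_ker_hsum_of_forall_mem_sat {hc2 : c * c = 1} {H : Subgroup G} (hH : H.index = 2) (hcH : c ∈ H)
    {A : Finset (CMF G c)} (hst : ∀ Q ∈ H, ∀ Ψ ∈ A, rt c Q Ψ ∈ A) (hdj : ∀ Q ∉ H, ∀ Ψ ∈ A, rt c Q Ψ ∉ A)
    (hsat : ∀ Ψ, Ψ ∈ sat c A) : rad2 c hc2 ≤ LinearMap.ker (hsum c A) :=
  rad2_le_ker_hsum c hH hcH hst hdj (face2_le_ker_hsum_sat_of_forall_mem c hsat)

/-! ## §6 Transgression: invariant functionals of the ambient module are block-parity combinations -/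

/-- **The base-change-invariant functionals of `𝔽₂[types]` are exactly the block-parity combinations** `Σ_b a_b · par2_b`
(Frobenius reciprocity for the permutation module `⊕_b 𝔽₂[G/Stab_b]`). [folklore] -/
theorem exists_eq_sum_par2_of_invariant (w : (CMF G c →₀ ZMod 2) →ₗ[ZMod 2] ZMod 2)
    (hw : ∀ (Q : G) (x : CMF G c →₀ ZMod 2), w (Finsupp.mapDomain (rt c Q) x) = w x) :
    ∃ a : Block c → ZMod 2, ∀ x, w x = ∑ b, a b * par2 c x b := by
  refine ⟨fun b => w (Finsupp.single (Quotient.out b) 1), fun x => ?_⟩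
  induction x using Finsupp.induction_linear with
  | zero => simp
  | add f g hf hg => rw [map_add, hf, hg, ← Finset.sum_add_distrib]; simp only [map_add, Pi.add_apply, mul_add]
  | single Ψ r =>
    rw [sum_mul_par2_single]
    have hb : blk c (Quotient.out (blk c Ψ)) = blk c Ψ := Quotient.out_eq _
    obtain ⟨Q, hQ⟩ := exists_rt_eq_of_blk_eq c hb
    have e : Finsupp.single Ψ r = r • Finsupp.mapDomain (rt c Q) (Finsupp.single (Quotient.out (blk c Ψ)) 1) := by
      rw [Finsupp.mapDomain_single, hQ, Finsupp.smul_single, smul_eq_mul, mul_one]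
    rw [e, map_smul, hw, smul_eq_mul]

/-- **Transgression.**  If the half-parity `hsum A` is NOT a block-parity combination on the faces mod `2` («new»), then it is
the restriction to the faces of NO base-change-invariant functional of the ambient `𝔽₂[types]` — although (§5) it is
`G`-invariant on the Hodge lattice. [folklore] -/
theorem not_exists_invariant_extension {hc2 : c * c = 1} {A : Finset (CMF G c)}
    (hnew : ∀ a : Block c → ZMod 2, ∃ x ∈ face2 c hc2, hsum c A x ≠ ∑ b, a b * par2 c x b) :
    ¬ ∃ w : (CMF G c →₀ ZMod 2) →ₗ[ZMod 2] ZMod 2,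
        (∀ (Q : G) (x : CMF G c →₀ ZMod 2), w (Finsupp.mapDomain (rt c Q) x) = w x) ∧
          ∀ x ∈ face2 c hc2, w x = hsum c A x := by
  rintro ⟨w, hw, hwA⟩
  obtain ⟨a, ha⟩ := exists_eq_sum_par2_of_invariant c w hw
  obtain ⟨x, hx, hne⟩ := hnew a
  exact hne (by rw [← hwA x hx, ha])

/-- Conversely every block-parity combination IS an invariant ambient functional. [folklore] -/
theorem sum_par2_mapDomain_rt (a : Block c → ZMod 2) (Q : G) (x : CMF G c →₀ ZMod 2) :
    ∑ b, a b * par2 c (Finsupp.mapDomain (rt c Q) x) b = ∑ b, a b * par2 c x b := by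
  rw [par2_mapDomain_rt]

end

end Summit.HodgeConjecture.CorCM.Census.HalfParity
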